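import Literature.IUT.HodgeTheaters.Cor53iFcircLiftsAllAtOpenEmbedding
import Literature.AlgebraicGeometry.Frobenioids.PadicFrobenioidPairIsoTopological
import Literature.AnabelianGeometry.AbsoluteAnabelian.NeukirchUchidaTheorem
import Literature.AnabelianGeometry.AbsoluteAnabelian.NFGaloisNotTFGProofs
import HarnessLib

/-!
# [IUTchI] Cor 5.3 (i) «respectively ⊚»: the LIFT-route law at an ARBITRARY Galois-countable push carrier `ι : H → G_F` —
# `hlift⊚` ⟸ «every topological automorphism of `H` normalises `Ker ι`» (KER-STABLE) ⟺ «`ι` is Neukirch–Uchida-compatible»; FACT ∅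

S. Mochizuki, *Inter-universal Teichmüller theory I*, kurims manuscript (May 2020), §5 Cor 5.3 (i) p. 144 l. 2–11, proof l. 24–33;
Example 5.1 (i) p. 123 l. 33–38 (`π₁(†𝒟^⊚) ↪ π₁(†𝒟^⊛)` an open INJECTION), (iii) pp. 125–126, (v) pp. 127–129 ([IUTchI] Cor 5.3 (i) p.144)
[claim: Mochizuki2012, status: disputed] (D-0012 claim key; PROOFS ONLY over landed files; nothing of the series is asserted; no side
taken on [IUTchIII] Cor. 3.12).  CLASSICAL inputs (OURS): [NSW] Thm (12.2.1) — the tree's THEOREM ★ `neukirchUchida_holds` (abc-iut-L4-d2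
p458975) [cite: NeukirchSchmidtWingberg2008, Thm (12.2.1)]; [FrdII] Ex 1.3 (ii)–(iii) pp. 11–12 (`φ_*`, `φ^*`) and Thm 2.4 p. 19 (descent of
a homeomorphism to the images of open homomorphisms) [cite: MochizukiFrdII2008, Thm 2.4 p.19]; [SemiAnbd] Prop 3.2 p. 35
[cite: MochizukiSemiAnbd2006, Prop 3.2 p.35]; [FrdI] Ex 6.3 p. 113 [cite: MochizukiFrdI2008, Ex. 6.3 p.113].

PROOF-ONLY (cell abc-iut, seat abc-iut-L5-t11 gen 23, row «HLIFT⊚-LAW@PUSH = KER-STABLE»; 0 def · 0 instance · 0 abbrev · 0 notation · no Prop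
fact).  ★ `Cor53iFcircLiftsAllAtOpenEmbedding` / ★ `Cor53iNeukirchUchidaDischarged` proved `hlift⊚` (hence «bijective») at every open
EMBEDDING `ι : H ↪ G_F`; abc-iut-L5-t4's exact DESCENT-route law is `hdesc⊚ ⟺ AutCompatible ι` (★ `Cor53iFcircHdescIffAutCompatible`).
THIS FILE is the LIFT-route twin at an ARBITRARY continuous open `ι : H → G_F` with `H` Galois-countable (NOT assumed injective):
* §1 the law, GROUP-THEORETIC and FACT-free: `nuCompatible_iff_kerStable` — «every topological automorphism `φ` of `H` is conjugation by a
  field automorphism `τ` of `F̄` through `ι`» ⟺ «every `φ` maps `Ker ι` into `Ker ι`» (`⟸`: `φ` descends to a topological automorphism of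
  the open subgroup `ι(H) ≅ H / Ker ι` — [FrdII] Thm 2.4's descent, abc-iut-L1's ★ `BaseGaloisSystem.exists_continuousMulEquiv_range` — to
  which the Neukirch–Uchida THEOREM applies at `U₁ = U₂ = ι(H)`; `⟹`: evaluate at `h ∈ Ker ι`); `kerStable_of_injective` (vacuous at
  embeddings);
* §2 `GlobalFrobenioid.liftsAll_fcircBase_arith_of_pushCarrier_of_nuCompatible` / `…_of_kerStable` — `hlift⊚` for EVERY record over the push
  carrier, the proof of ★ p562181 §3 VERBATIM with its two uses of injectivity replaced (Galois-countability is now a hypothesis; `τ` from the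
  law); §1–§2 of ★ p562181 and abc-iut-w4-d109's ★ `ArithDivisorData.exists_equivalence_over_of_ringEquiv` were already injectivity-free;
* §3 KNIT `Cor53.fcirc_descendBijective_of_pushCarrier_of_kerStable (hZ) (hK)` — «bijective» ⟸ LAW {KER-STABLE} · {`hZ : H` slim} · FACT ∅ ·
  SIDE ∅ (injectivity ★ `Cor53.fcirc_rigidOverBase_of_pushCarrier`);
* §4 `not_kerStable_fstPushCarrier` — at the `pr₁` carrier `H := G_F × G_F`, `ι := pr₁` (the literal carrier of ★ `Cor53.not_hdesc_fstPushCarrier`)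
  the law FAILS (the swap moves the kernel): the SAME carrier at which abc-iut-L5-t4 shows `hlift⊚` itself false — so the law is
  NECESSARY IN KIND.  NOT claimed: the outright converse `hlift⊚ ⟹ KER-STABLE` (honest open end).
HONEST LABEL: OUR stand-in carriers (push along `ι` of `ℬ(H)⁰`; print's `ι` is `π₁(C_K) ↪ π₁(C_{F_mod})` with `F`-coricity, Ex 5.1 (i)) and
OUR lift route; typed ≠ inhabited ≠ proved-in-print; no side on [IUTchIII] Cor 3.12; not an abc claim.
-/

set_option backward.isDefEq.respectTransparency false

noncomputable section

namespace Literature.IUT.HodgeTheaters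

open CategoryTheory Opposite Function
open Literature.AlgebraicGeometry.Frobenioids Literature.AnabelianGeometry.SemiGraphs
open Literature.AlgebraicGeometry.Frobenioids.QuasiTemperoid Literature.NumberTheory.GaloisRepresentations
open Literature.AnabelianGeometry.AbsoluteAnabelian (neukirchUchida_holds)

universe v₁ v₂ v₃ u₁ u₂ u₃

/-! ### §1. The law: NU-compatibility of `ι` ⟺ `Aut_top(H)` normalises `Ker ι` — group theory + the Neukirch–Uchida THEOREM -/

section KerStable

variable (F : Type) [Field F] [NumberField F] (H : ProfiniteGrp.{0}) (ι : H →* GalFbar F) (hc : Continuous ι) (ho : IsOpenMap ι)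

omit [NumberField F] in
include hc ho in
/-- **A kernel-stable topological automorphism DESCENDS to the open image** ([FrdII] Thm 2.4's descent; abc-iut-L1's ★
`BaseGaloisSystem.exists_continuousMulEquiv_range` for the topology): for `ι : H → G_F` continuous open and `φ : H ⥲ H` with
`φ(Ker ι) = Ker ι`, there is a topological automorphism `α` of `ι(H)` with `α (ι h) = ι (φ h)`.
([IUTchI] Ex 5.1 (i) p.123) [cite: MochizukiFrdII2008, Thm 2.4 p.19] [claim: Mochizuki2012, status: disputed] -/
theorem exists_continuousMulEquiv_range_of_ker_map_eq (φ : H ≃ₜ* H) (hmap : ι.ker.map φ.toMulEquiv = ι.ker) :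
    ∃ α : ι.range ≃ₜ* ι.range, ∀ h : H, ((α ⟨ι h, ⟨h, rfl⟩⟩ : ι.range) : GalFbar F) = ι (φ h) := by
  let c : H ⧸ ι.ker ≃* H ⧸ ι.ker := QuotientGroup.congr ι.ker ι.ker φ.toMulEquiv hmap
  let e : H ⧸ ι.ker ≃* ι.range := QuotientGroup.quotientKerEquivRange ι
  let ψ : ι.range ≃* ι.range := e.symm.trans (c.trans e)
  have he : ∀ g : H, e (QuotientGroup.mk g) = ⟨ι g, ⟨g, rfl⟩⟩ := fun g => rfl
  have hψ : ∀ g : H, ((ψ ⟨ι g, ⟨g, rfl⟩⟩ : ι.range) : GalFbar F) = ι (φ g) := by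
    intro g
    have h2 : e.symm ⟨ι g, ⟨g, rfl⟩⟩ = QuotientGroup.mk g := by rw [← he, MulEquiv.symm_apply_apply]
    have h3 : c (QuotientGroup.mk g) = QuotientGroup.mk (φ g) := by
      rw [QuotientGroup.congr_mk]
      rfl
    change ((e (c (e.symm ⟨ι g, ⟨g, rfl⟩⟩)) : ι.range) : GalFbar F) = ι (φ g)
    rw [h2, h3, he]
  obtain ⟨α, hα⟩ := BaseGaloisSystem.exists_continuousMulEquiv_range ι ι hc ho hc ho φ ψ hψ
  exact ⟨α, fun h => by rw [hα]; exact hψ h⟩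

omit [NumberField F] in
/-- For `φ : H ⥲ H`, if EVERY topological automorphism of `H` maps `Ker ι` into `Ker ι`, then `φ(Ker ι) = Ker ι` (apply the hypothesis to
`φ` and to `φ⁻¹`). [cite: MochizukiFrdII2008, Thm 2.4 p.19] -/
theorem ker_map_eq_of_kerStable (hK : ∀ (ψ : H ≃ₜ* H) (h : H), ι h = 1 → ι (ψ h) = 1) (φ : H ≃ₜ* H) :
    ι.ker.map φ.toMulEquiv = ι.ker := by
  ext y
  rw [Subgroup.mem_map, MonoidHom.mem_ker]
  constructor
  · rintro ⟨x, hx, rfl⟩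
    exact hK φ x (MonoidHom.mem_ker.mp hx)
  · intro hy
    exact ⟨φ.symm y, MonoidHom.mem_ker.mpr (hK φ.symm y hy), φ.apply_symm_apply y⟩

include hc ho in
/-- **KER-STABLE ⟹ NU-compatible, FACT-free**: if every topological automorphism of `H` normalises `Ker ι`, then every `φ : H ⥲ H` is
conjugation through `ι` by a field automorphism `τ` of `F̄` — `ι(φ h) (τ x) = τ (ι(h) x)` — by the Neukirch–Uchida THEOREM (★
`neukirchUchida_holds F`, abc-iut-L4-d2 p458975) applied at `U₁ = U₂ := ι(H)` to the descended automorphism of the preceding theorem.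
([IUTchI] Cor 5.3 (i) p.144) [cite: NeukirchSchmidtWingberg2008, Thm (12.2.1)] [claim: Mochizuki2012, status: disputed] -/
theorem nuCompatible_of_kerStable (hK : ∀ (ψ : H ≃ₜ* H) (h : H), ι h = 1 → ι (ψ h) = 1) (φ : H ≃ₜ* H) :
    ∃ τ : Fbar F ≃+* Fbar F, ∀ (h : H) (x : Fbar F), ι (φ h) (τ x) = τ (ι h x) := by
  have hU : IsOpen ((ι.range : Subgroup (GalFbar F)) : Set (GalFbar F)) := by
    rw [MonoidHom.coe_range]
    exact ho.isOpen_range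
  let U : Subgroup (Field.absoluteGaloisGroup F) := ι.range
  obtain ⟨α, hα⟩ : ∃ α : U ≃ₜ* U, ∀ h : H, ((α ⟨ι h, ⟨h, rfl⟩⟩ : U) : Field.absoluteGaloisGroup F) = ι (φ h) :=
    exists_continuousMulEquiv_range_of_ker_map_eq F H ι hc ho φ (ker_map_eq_of_kerStable F H ι hK φ)
  obtain ⟨τ, hτ⟩ := neukirchUchida_holds F U U hU hU α
  refine ⟨τ, fun h x => ?_⟩
  have h1 := hτ ⟨ι h, ⟨h, rfl⟩⟩ x
  rw [hα h] at h1
  exact h1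

omit [NumberField F] in
/-- **NU-compatible ⟹ KER-STABLE** (evaluate at `h ∈ Ker ι`: `ι(φ h)` fixes `τ x` for all `x`, and `τ` is onto).
([IUTchI] Cor 5.3 (i) p.144) [claim: Mochizuki2012, status: disputed] -/
theorem kerStable_of_nuCompatible
    (hNUC : ∀ φ : H ≃ₜ* H, ∃ τ : Fbar F ≃+* Fbar F, ∀ (h : H) (x : Fbar F), ι (φ h) (τ x) = τ (ι h x))
    (φ : H ≃ₜ* H) (h : H) (hh : ι h = 1) : ι (φ h) = 1 := by
  obtain ⟨τ, hτ⟩ := hNUC φ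
  ext x
  obtain ⟨y, rfl⟩ := τ.surjective x
  rw [hτ, hh]
  rfl

include hc ho in
/-- **The LIFT-route law at a push carrier, EXACTLY**: NU-compatibility of `ι` ⟺ KER-STABILITY of `ι` — FACT-free (Neukirch–Uchida is
the tree's ★ `neukirchUchida_holds`). ([IUTchI] Cor 5.3 (i) p.144) [cite: NeukirchSchmidtWingberg2008, Thm (12.2.1)]
[claim: Mochizuki2012, status: disputed] -/
theorem nuCompatible_iff_kerStable :
    (∀ φ : H ≃ₜ* H, ∃ τ : Fbar F ≃+* Fbar F, ∀ (h : H) (x : Fbar F), ι (φ h) (τ x) = τ (ι h x)) ↔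
      ∀ (φ : H ≃ₜ* H) (h : H), ι h = 1 → ι (φ h) = 1 :=
  ⟨fun hNUC φ h hh => kerStable_of_nuCompatible F H ι hNUC φ h hh, fun hK φ => nuCompatible_of_kerStable F H ι hc ho hK φ⟩

omit [NumberField F] in
/-- KER-STABILITY is VACUOUS at an injective `ι` (open embeddings): `Ker ι = 1`. ([IUTchI] Ex 5.1 (i) p.123)
[claim: Mochizuki2012, status: disputed] -/
theorem kerStable_of_injective (hinj : Injective ι) (φ : H ≃ₜ* H) (h : H) (hh : ι h = 1) : ι (φ h) = 1 := by
  rw [← map_one ι] at hh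
  rw [hinj hh, map_one, map_one]

end KerStable

/-! ### §2. `hlift⊚` at an ARBITRARY Galois-countable push carrier from NU-compatibility / KER-STABILITY -/

namespace GlobalFrobenioid

variable (F : Type) [Field F] [NumberField F]

/-- **`hlift⊚` at the push carrier of ANY continuous open `ι : H → G_F` (`H` profinite, Galois-countable; `ι` NOT assumed injective) whose
topological automorphisms are NU-compatible, for EVERY record, FACT ∅**: every self-equivalence `Θ` of `†𝒟^⊚ = ℬ(H)⁰` lifts to a
self-equivalence of `†ℱ^⊚` lying over it.  The proof of abc-iut-L5-t11's ★ `liftsAll_fcircBase_arith_of_openEmbedding_of_neukirchUchida`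
(p562181 §3) VERBATIM, with Galois-countability a hypothesis and `τ` taken from the law: `Θ ≅ (φ⁻¹)^*` ([SemiAnbd] Prop 3.2),
`ι(φ h) ∘ τ = τ ∘ ι(h)`, `a ↦ τ a` natural on the push carrier (★ p562181 §1–§2), [FrdI] Ex 6.3 functorial in ring isomorphisms
(abc-iut-w4-d109's ★ `ArithDivisorData.exists_equivalence_over_of_ringEquiv`) on the whiskered model, §0 transport.
([IUTchI] Cor 5.3 (i) p.144) [cite: MochizukiFrdI2008, Ex. 6.3 p.113] [cite: MochizukiSemiAnbd2006, Prop 3.2 p.35]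
[claim: Mochizuki2012, status: disputed] -/
theorem liftsAll_fcircBase_arith_of_pushCarrier_of_nuCompatible
    (H : ProfiniteGrp.{0}) [SecondCountableTopology H] (ι : H →* GalFbar F) (ho : IsOpenMap ι)
    (hNUC : ∀ φ : H ≃ₜ* H, ∃ τ : Fbar F ≃+* Fbar F, ∀ (h : H) (x : Fbar F), ι (φ h) (τ x) = τ (ι h x))
    (𝓕 : GlobalFrobenioid (GlobalDivisorData.arith F) (BaseCat H)
      (baseToCoset H ⋙ CosetCat.push ι ho ⋙ cosetToBase (absGalGrp F))) :
    ∀ Θ : BaseCat H ≌ BaseCat H, ∃ Ψ : 𝓕.Fcirc ≌ 𝓕.Fcirc,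
      Nonempty (CatIsomorphism.LiesUnder 𝓕.fcircBase 𝓕.fcircBase Ψ Θ) := by
  intro Θ
  haveI : IsGalois F (Fbar F) := isGalois_fbar F
  haveI := BCat.connectedToBTemp_isEquivalence H
  haveI := BCat.connectedToBTemp_isEquivalence (absGalGrp F)
  have hTH : IsTempered H := IsTempered.of_profinite
  have hT : IsTempered (GalFbar F) := IsTempered.of_profinite
  -- (1) `†ℱ^⊚ ≌` the whiskered model over `ℬ(H)⁰`; by ★ p562181 §0 lift `Θ` there
  obtain ⟨Q, hQ⟩ := 𝓕.exists_fcirc_equivalence_fiberProduct_over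
  obtain ⟨E, hE, -⟩ := ModelFrobenioid.exists_fiberProduct_equivalence (GlobalDivisorData.arith F).Φ
    (GlobalDivisorData.arith F).B (GlobalDivisorData.arith F).div (𝓕.baseMor ⋙ 𝓕.identify.functor)
  refine CatIsomorphism.exists_lift_of_equivalence_over Q (eqToIso hQ)
    (CatIsomorphism.exists_lift_of_equivalence_over E (eqToIso hE) ?_)
  -- (2) the bridge `Bα := α₁ ⋙ (ℬ(H)⁰ ⥲ CosetCat H)` and the conjugate self-equivalence `Ξ` of `CosetCat H`
  haveI : (baseToCoset H).IsEquivalence := Functor.isEquivalence_trans _ _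
  let Bα : BaseCat H ≌ CosetCat H := 𝓕.α₁.trans (baseToCoset H).asEquivalence
  let Ξ : CosetCat H ≌ CosetCat H := Bα.symm.trans (Θ.trans Bα)
  have ξ₀ : Θ.functor ⋙ Bα.functor ≅ Bα.functor ⋙ Ξ.functor :=
    (Functor.leftUnitor _).symm ≪≫ Functor.isoWhiskerRight Bα.unitIso (Θ.functor ⋙ Bα.functor) ≪≫ Functor.associator _ _ _
  -- (3) [SemiAnbd] Prop 3.2 on the coset model (`H` Galois-countable): `Ξ ≅ (φ⁻¹)^*`
  obtain ⟨φ, hφc, hφs, ⟨k⟩⟩ := CosetCat.exists_continuousMulEquiv_nonempty_iso_pull hTH hTH Ξ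
  have ξ : Θ.functor ⋙ Bα.functor ≅ Bα.functor ⋙ CosetCat.pull φ.symm.toMonoidHom hφc hφs :=
    ξ₀ ≪≫ Functor.isoWhiskerLeft Bα.functor k
  -- (4) the law: `τ` with `ι(φ h) ∘ τ = τ ∘ ι(h)`
  obtain ⟨τ, hτ⟩ := hNUC φ
  have hτ' : ∀ (h : H) (x : Fbar F), ι h (τ x) = τ (ι (φ.symm.toMonoidHom h) x) := fun h x => by
    have h1 := hτ (φ.symm h) x; rwa [ContinuousMulEquiv.apply_symm_apply] at h1
  -- (5) the natural family `a ↦ τ a`, transported to `S := T ⋙ galoisSubextOfFinite F`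
  obtain ⟨ρ', hρ'⟩ := PushCarrier.exists_ringEquiv_family_of_push_twist ι ho φ.symm.toMonoidHom hφc hφs τ hτ' Bα.functor Θ.functor ξ
  obtain ⟨e₂⟩ := nonempty_toConnected_galoisSubext_iso_cosetFixedSubext F hT
  have jS : (𝓕.baseMor ⋙ 𝓕.identify.functor) ⋙ galoisSubextOfFinite F ≅
      Bα.functor ⋙ CosetCat.push ι ho ⋙ cosetFixedSubext F := by
    refine Functor.isoWhiskerRight 𝓕.compat.symm (galoisSubextOfFinite F) ≪≫ ?_
    refine (Functor.isoWhiskerLeft (Bα.functor ⋙ CosetCat.push ι ho ⋙ CosetCat.toConnected hT)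
      (Functor.isoWhiskerRight (BCat.connectedToBTemp (absGalGrp F)).asEquivalence.counitIso (galoisSubext F)) :
        (Bα.functor ⋙ CosetCat.push ι ho ⋙ CosetCat.toConnected hT) ⋙
            ((BCat.connectedToBTemp (absGalGrp F)).inv ⋙ BCat.connectedToBTemp (absGalGrp F)) ⋙ galoisSubext F ≅
          (Bα.functor ⋙ CosetCat.push ι ho ⋙ CosetCat.toConnected hT) ⋙ 𝟭 _ ⋙ galoisSubext F) ≪≫ ?_
    exact Functor.isoWhiskerLeft (Bα.functor ⋙ CosetCat.push ι ho) e₂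
  obtain ⟨ρ, hρ⟩ := PushCarrier.exists_ringEquiv_family_of_iso Θ.functor _ _ jS ρ' hρ'
  -- (6) [FrdI] Ex 6.3 is functorial in ring isomorphisms: a self-equivalence of the whiskered model over `Θ` ON THE NOSE
  obtain ⟨Ψ, hΨ, -⟩ := ArithDivisorData.exists_equivalence_over_of_ringEquiv
    ((𝓕.baseMor ⋙ 𝓕.identify.functor) ⋙ galoisSubextOfFinite F)
    ((𝓕.baseMor ⋙ 𝓕.identify.functor) ⋙ galoisSubextOfFinite F) Θ.functor ρ hρ
  exact ⟨Ψ, ⟨eqToIso hΨ⟩⟩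

/-- **`hlift⊚` at the push carrier of ANY continuous open `ι : H → G_F` whose topological automorphisms normalise `Ker ι`, for EVERY
record — FACT ∅** (§1 + the preceding theorem). ([IUTchI] Cor 5.3 (i) p.144) [cite: NeukirchSchmidtWingberg2008, Thm (12.2.1)]
[claim: Mochizuki2012, status: disputed] -/
theorem liftsAll_fcircBase_arith_of_pushCarrier_of_kerStable
    (H : ProfiniteGrp.{0}) [SecondCountableTopology H] (ι : H →* GalFbar F) (hc : Continuous ι) (ho : IsOpenMap ι)
    (hK : ∀ (φ : H ≃ₜ* H) (h : H), ι h = 1 → ι (φ h) = 1)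
    (𝓕 : GlobalFrobenioid (GlobalDivisorData.arith F) (BaseCat H)
      (baseToCoset H ⋙ CosetCat.push ι ho ⋙ cosetToBase (absGalGrp F))) :
    ∀ Θ : BaseCat H ≌ BaseCat H, ∃ Ψ : 𝓕.Fcirc ≌ 𝓕.Fcirc,
      Nonempty (CatIsomorphism.LiesUnder 𝓕.fcircBase 𝓕.fcircBase Ψ Θ) :=
  liftsAll_fcircBase_arith_of_pushCarrier_of_nuCompatible F H ι ho (nuCompatible_of_kerStable F H ι hc ho hK) 𝓕

end GlobalFrobenioid

/-! ### §3. KNIT — «⊚ bijective» at a KER-STABLE push carrier: LAW {KER-STABLE} · {`hZ`} · FACT ∅ · SIDE ∅ -/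

section Knit

variable (F : Type) [Field F] [NumberField F]

/-- **[IUTchI] Cor 5.3 (i) «resp. `⊚`» («bijective») at the push carrier of ANY continuous open `ι : H → G_F`** (`H` profinite,
Galois-countable, slim), for EVERY record — modulo LAW {KER-STABLE: every topological automorphism of `H` normalises `Ker ι`} ONLY: FACT ∅ ·
SIDE ∅ (injectivity: abc-iut-L5-t4's ★ `Cor53.fcirc_rigidOverBase_of_pushCarrier` from `hZ`; surjectivity: §2).  At open embeddings
KER-STABLE is vacuous and `hZ` follows from the slimness of `G_F` (★ `Cor53.fcirc_descendBijective_of_openEmbedding`); at `pr₁` it FAILS (§4).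
OUR carrier and OUR lift route. ([IUTchI] Cor 5.3 (i) p.144) [cite: NeukirchSchmidtWingberg2008, Thm (12.2.1)]
[cite: MochizukiFrdI2008, Prop. 1.6 p.27] [claim: Mochizuki2012, status: disputed] -/
theorem Cor53.fcirc_descendBijective_of_pushCarrier_of_kerStable
    (H : ProfiniteGrp.{0}) [SecondCountableTopology H] (ι : H →* GalFbar F) (hc : Continuous ι) (ho : IsOpenMap ι) (hZ : IsSlimGroup H)
    (hK : ∀ (φ : H ≃ₜ* H) (h : H), ι h = 1 → ι (φ h) = 1)
    (𝓕 : GlobalFrobenioid (GlobalDivisorData.arith F) (BaseCat H)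
      (baseToCoset H ⋙ CosetCat.push ι ho ⋙ cosetToBase (absGalGrp F))) :
    CatIsomorphism.DescendBijective 𝓕.fcircBase 𝓕.fcircBase
      (GlobalFrobenioid.hasUnder_and_underUnique_fcircBase_arith_baseCat 𝓕 𝓕 hZ hZ).1
      (GlobalFrobenioid.hasUnder_and_underUnique_fcircBase_arith_baseCat 𝓕 𝓕 hZ hZ).2 :=
  fcirc_descendBijective_of_kernel_trivial_of_lifts 𝓕 hZ (Cor53.fcirc_rigidOverBase_of_pushCarrier F H ι hc ho hZ 𝓕)
    (GlobalFrobenioid.liftsAll_fcircBase_arith_of_pushCarrier_of_kerStable F H ι hc ho hK 𝓕)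

end Knit

/-! ### §4. NECESSITY IN KIND: at the `pr₁` carrier `G_F × G_F ↠ G_F` the law FAILS (the swap moves the kernel) -/

section Fst

variable (F : Type) [Field F] [NumberField F]

/-- **KER-STABILITY FAILS at the `pr₁` push carrier** `H := G_F × G_F`, `ι := pr₁` (the literal carrier of abc-iut-L5-t4's ★
`Cor53.not_hdesc_fstPushCarrier`): the swap `(σ, σ') ↦ (σ', σ)` is a topological automorphism of `H` moving `(1, g) ∈ Ker pr₁` to
`(g, 1) ∉ Ker pr₁` for any `g ≠ 1` (`G_F ≠ 1`: it has an open subgroup of index `2`, abc-iut-L4's ★ `infinite_setOf_isOpen_index_two_gal`).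
At this carrier `hlift⊚` itself is false (abc-iut-L5-t4 gen 12), so the law of §2–§3 is NECESSARY IN KIND; the outright converse
`hlift⊚ ⟹ KER-STABLE` is NOT claimed here. ([IUTchI] Cor 5.3 (i) p.144) [cite: MochizukiFrdII2008, Ex 1.3 (ii) p.11]
[claim: Mochizuki2012, status: disputed] -/
theorem not_kerStable_fstPushCarrier :
    ¬ ∀ (φ : (ProfiniteGrp.of (absGalGrp F × absGalGrp F) : ProfiniteGrp.{0}) ≃ₜ* ProfiniteGrp.of (absGalGrp F × absGalGrp F))
        (h : (ProfiniteGrp.of (absGalGrp F × absGalGrp F) : ProfiniteGrp.{0})),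
        MonoidHom.fst (absGalGrp F) (absGalGrp F) h = 1 → MonoidHom.fst (absGalGrp F) (absGalGrp F) (φ h) = 1 := by
  intro hK
  -- a nontrivial element of `G_F`
  obtain ⟨V, hVo, hVi⟩ := (Literature.AnabelianGeometry.AbsoluteAnabelian.infinite_setOf_isOpen_index_two_gal F).nonempty
  have hg : ∃ g : absGalGrp F, g ≠ 1 := by
    by_contra hall
    have htop : V = ⊤ := (Subgroup.eq_top_iff' V).mpr fun g => by
      rw [not_not.mp (not_exists.mp hall g)]; exact V.one_mem
    rw [htop, Subgroup.index_top] at hVi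
    exact absurd hVi (by norm_num)
  obtain ⟨g, hg1⟩ := hg
  -- the swap, as a topological automorphism of `G_F × G_F`
  let sw : (ProfiniteGrp.of (absGalGrp F × absGalGrp F) : ProfiniteGrp.{0}) ≃ₜ* ProfiniteGrp.of (absGalGrp F × absGalGrp F) :=
    { MulEquiv.prodComm with
      continuous_toFun := continuous_swap
      continuous_invFun := continuous_swap }
  have h1 : MonoidHom.fst (absGalGrp F) (absGalGrp F) ((1, g) : absGalGrp F × absGalGrp F) = 1 := rfl
  have h2 := hK sw ((1, g) : absGalGrp F × absGalGrp F) h1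
  exact hg1 h2

end Fst

end Literature.IUT.HodgeTheaters

end
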